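import Summits.CriticalPhenomena.SAWScalingLimit.Theorems.SAWRenewalTightnessStripMassConservation
import Summits.CriticalPhenomena.SAWScalingLimit.Theorems.SAWTotalPositivityCriticalBubbleBoundKestenHWSpanLength
import Literature.Probability.RandomPlanarGeometry.SAWWordBridges
import Literature.Probability.RandomPlanarGeometry.SAWCount
import HarnessLib

/-!
# Crux `ConfinementPositivity` (stmt-CriticalPhenomena-17587), line `Sketch` (card `sign-universality`),
# stub B′p0 `stub_slabOfChain`, part 1: Kesten chains versus slab walks (`SlabOfChain.*`)

Helper file for the registered stub `stub_slabOfChain : ChainPinnedTube → SlabTubeConfinement`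
(proved in `…ConfinementPositivitySlabOfChain.lean`, which imports this file): the word-level
combinatorics identifying the two currencies of the line — Kesten CHAINS (lists of irreducible bridge
words, `IsIrrBridge` of `SAWWordBridges.lean`, glued by `List.flatten`) and SLAB WALKS (vertex
functions `ω ∈ Zd.sawFun 2 n (L, h)` of `SAWCount.lean` with `0 ≤ x ≤ L` throughout).

* Concatenations: `isBridgeW_flatten`, `isSAW_flatten` (Madras–Slade (1.2.15), from the tree's
  `IsBridgeW.append`, `IsSAW.append_of_bridge`), `xEnd_flatten` (spans add).
* **Kesten's factorisation** of a self-avoiding bridge word into irreducible bridge words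
  (Kesten 1963, §4; Madras–Slade 1993, §4.2): existence `exists_chain_eq_flatten` (split off the first
  irreducible factor, the tree's `StripMass.exists_irrBridge_append`, and recurse on the shorter tail)
  and uniqueness `slabOfChain_flatten_injective` — the registered helper stub of this file — (the tree's
  unique decoding `eq_of_append_eq'`, then induction).
* The east step: a non-empty bridge word starts with `+e₀` (`head_eq_zero`); `xAt_cons_succ`
  (with `traj_cons_succ`, `xAt_nonneg_of_isBridgeW` of the tree's `…CriticalBubbleBoundKestenHWSpanLength.lean`).
* Finiteness `length_lt_of_tube`: a self-avoiding bridge word of span `L + 1` with heights in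
  `|y₀ + y| ≤ X` has `< (L + 2)(2X + 1)` steps (it visits distinct points of a box).
* The dictionary: `cons_wordOf_spec` (slab walk `ω` ↦ the self-avoiding bridge word `E :: wordOf n ω`
  of span `L + 1`, same heights after the first vertex) and `tail_spec` (such a word `b` ↦ the slab walk
  `traj b.tail`, with `wordOf _ (traj b.tail) = b.tail`), i.e. the two maps are mutually inverse.

Elementary; sources: H. Kesten, *On the number of self-avoiding walks*, J. Math. Phys. 4 (1963), §4;
N. Madras, G. Slade, *The Self-Avoiding Walk* (1993), §1.1–1.2, §4.2. No `def`s, no named facts.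
-/

noncomputable section
open scoped BigOperators
open Literature.Probability.LatticeModels Literature.Probability.RandomPlanarGeometry
  Literature.Probability.RandomPlanarGeometry.SAW

namespace Summit.CriticalPhenomena.SAWScalingLimit.Theorems

-- `traj (d :: z) (j + 1) = vec d + traj z j` and `0 ≤ xAt w i` for bridge words, from the tree
open Summit.CriticalPhenomena.SAWScalingLimit.Theorems.CriticalBubbleBound.Kesten.HW
  (traj_cons_succ xAt_nonneg_of_isBridgeW)

namespace SlabOfChain

/-! ### Concatenations (`List.flatten`) of bridge words -/

/-- The concatenation of a list of bridge words is a bridge word.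
[cite: MadrasSlade1993, §1.2, eq. (1.2.15)] -/
theorem isBridgeW_flatten : ∀ {l : List (List Step)}, (∀ w ∈ l, IsBridgeW w) → IsBridgeW l.flatten
  | [], _ => by rw [List.flatten_nil]; exact isBridgeW_nil
  | w :: l, h => by
    rw [List.flatten_cons]
    exact (h w (by simp)).append (isBridgeW_flatten fun v hv => h v (by simp [hv]))

/-- The concatenation of a list of self-avoiding bridge words is self-avoiding.
[cite: MadrasSlade1993, §1.2, eq. (1.2.15)] -/
theorem isSAW_flatten : ∀ {l : List (List Step)}, (∀ w ∈ l, IsSAW w) → (∀ w ∈ l, IsBridgeW w) →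
    IsSAW l.flatten
  | [], _, _ => by rw [List.flatten_nil]; exact isSAW_nil
  | w :: l, hs, hb => by
    rw [List.flatten_cons]
    exact (hs w (by simp)).append_of_bridge
      (isSAW_flatten (fun v hv => hs v (by simp [hv])) fun v hv => hb v (by simp [hv]))
      (hb w (by simp)) (isBridgeW_flatten fun v hv => hb v (by simp [hv]))

/-- The span of a concatenation is the sum of the spans. [folklore] -/
theorem xEnd_flatten : ∀ l : List (List Step), xEnd l.flatten = (l.map xEnd).sum
  | [] => by simp [xEnd]
  | w :: l => by
    rw [List.flatten_cons, xEnd_append, xEnd_flatten l, List.map_cons, List.sum_cons]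

/-! ### Kesten's factorisation into irreducible bridges: existence and uniqueness -/

/-- **Kesten's factorisation, existence**: every self-avoiding bridge word (here of length `≤ n`, for
the induction) is the concatenation of a list of irreducible bridge words — split off the first
irreducible factor (`StripMass.exists_irrBridge_append`) and recurse on the shorter tail.
[cite: Kesten1963SAW, §4] -/
theorem exists_chain_eq_flatten : ∀ (n : ℕ) (b : List Step), b.length ≤ n → IsSAW b → IsBridgeW b →
    ∃ l : List (List Step), (∀ w ∈ l, IsIrrBridge w) ∧ l.flatten = b
  | 0, b, hn, _, _ => by
    have hb : b = [] := List.length_eq_zero_iff.1 (Nat.le_zero.1 hn)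
    exact ⟨[], by simp, by rw [hb, List.flatten_nil]⟩
  | n + 1, b, hn, hs, hb => by
    by_cases hne : b = []
    · exact ⟨[], by simp, by rw [hne, List.flatten_nil]⟩
    · obtain ⟨s, t, rfl, hsirr, ht⟩ := StripMass.exists_irrBridge_append hs hb hne
      have hts : IsSAW t := by
        have := hs.drop s.length
        rwa [List.drop_left] at this
      have hs1 : 1 ≤ s.length := List.length_pos_iff.2 hsirr.ne_nil
      have htn : t.length ≤ n := by
        rw [List.length_append] at hn
        omega
      obtain ⟨l, hl, hfl⟩ := exists_chain_eq_flatten n t htn hts ht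
      refine ⟨s :: l, fun w hw => ?_, by rw [List.flatten_cons, hfl]⟩
      rcases List.mem_cons.1 hw with rfl | hw
      · exact hsirr
      · exact hl w hw

/-- A concatenation of irreducible bridge words is empty only if the list is empty (irreducible
bridges are non-empty words). [cite: Kesten1963SAW, §4] -/
theorem eq_nil_of_flatten_eq_nil : ∀ {l : List (List Step)}, (∀ w ∈ l, IsIrrBridge w) →
    l.flatten = [] → l = []
  | [], _, _ => rfl
  | w :: _, h, hl => absurd (List.flatten_eq_nil_iff.1 hl w (by simp)) (h w (by simp)).ne_nil

end SlabOfChain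

/-- **Kesten's factorisation, uniqueness** (the registered helper stub
`slabOfChain_flatten_injective` of stmt-CriticalPhenomena-17587): two lists of irreducible bridge
words with the same concatenation are equal (the first factors agree by unique decoding
`eq_of_append_eq'`, the tails are bridges by `SlabOfChain.isBridgeW_flatten`, then induction).
[cite: Kesten1963SAW, §4] -/
theorem slabOfChain_flatten_injective : ∀ (l₁ l₂ : List (List Step)), (∀ w ∈ l₁, IsIrrBridge w) →
    (∀ w ∈ l₂, IsIrrBridge w) → l₁.flatten = l₂.flatten → l₁ = l₂ := by
  intro l₁
  induction l₁ with
  | nil =>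
    intro l₂ _ h₂ h
    exact (SlabOfChain.eq_nil_of_flatten_eq_nil h₂ (by rw [← h, List.flatten_nil])).symm
  | cons s l₁ ih =>
    intro l₂ h₁ h₂ h
    cases l₂ with
    | nil => exact SlabOfChain.eq_nil_of_flatten_eq_nil h₁ (by rw [h, List.flatten_nil])
    | cons s' l₂ =>
      rw [List.flatten_cons, List.flatten_cons] at h
      have hb₁ : IsBridgeW l₁.flatten :=
        SlabOfChain.isBridgeW_flatten fun w hw => (h₁ w (by simp [hw])).bridge
      have hb₂ : IsBridgeW l₂.flatten :=
        SlabOfChain.isBridgeW_flatten fun w hw => (h₂ w (by simp [hw])).bridge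
      obtain ⟨rfl, h'⟩ := eq_of_append_eq' (h₁ s (by simp)) (h₂ s' (by simp)) hb₁ hb₂ h
      rw [ih l₂ (fun w hw => h₁ w (by simp [hw])) (fun w hw => h₂ w (by simp [hw])) h']

namespace SlabOfChain

/-! ### The first (east) step of a bridge word -/

/-- `dx(+e₀) = 1`. [folklore] -/
theorem dx_zero : Step.dx 0 = 1 := by decide

/-- `dy(+e₀) = 0`. [folklore] -/
theorem dy_zero : Step.dy 0 = 0 := by decide

/-- The only step with positive first coordinate is `+e₀`. [folklore] -/
theorem eq_zero_of_dx_pos : ∀ {d : Step}, 0 < Step.dx d → d = 0 := by decide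

/-- First coordinates after one more initial step: `x_{d :: w}(i + 1) = dx d + x_w(i)`. [folklore] -/
theorem xAt_cons_succ (d : Step) (w : List Step) (i : ℕ) :
    xAt (d :: w) (i + 1) = Step.dx d + xAt w i := by
  simp only [xAt, traj_cons_succ, Pi.add_apply, Step.vec_apply_zero]

/-- A non-empty bridge word starts with the east step `+e₀` (its first coordinate after one step
is positive). [cite: MadrasSlade1993, Definition 1.2.4] -/
theorem head_eq_zero {d : Step} {w : List Step} (hb : IsBridgeW (d :: w)) : d = 0 := by
  have h := ((isBridgeW_iff _).1 hb 1 le_rfl (by simp)).1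
  have e : xAt (d :: w) 1 = Step.dx d := by simpa using xAt_cons_succ d w 0
  rw [e] at h
  exact eq_zero_of_dx_pos h

/-! ### Finiteness: a self-avoiding word in a box is short -/

/-- **Finiteness.** A self-avoiding bridge word of span `L + 1` all of whose heights `y` satisfy
`|y₀ + y| ≤ X` visits `|b| + 1` distinct points of the box `[0, L+1] × [-X-y₀, X-y₀]`, so
`|b| < (L + 2)(2X + 1)`. [folklore] -/
theorem length_lt_of_tube {b : List Step} (hs : IsSAW b) (hb : IsBridgeW b) {L X : ℕ} {y₀ : ℤ}
    (hx : xEnd b = (L : ℤ) + 1) (ht : ∀ i, |y₀ + traj b i 1| ≤ (X : ℤ)) :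
    b.length < (L + 2) * (2 * X + 1) := by
  have hinj := (isSAW_iff_injOn b).1 hs
  have key : (Finset.range (b.length + 1)).card ≤
      (Finset.Icc (0 : ℤ) ((L : ℤ) + 1) ×ˢ Finset.Icc (-(X : ℤ) - y₀) ((X : ℤ) - y₀)).card := by
    refine Finset.card_le_card_of_injOn (fun i => (xAt b i, traj b i 1)) (fun i _ => ?_) ?_
    · have h1 := xAt_nonneg_of_isBridgeW hb i
      have h2 := hb.xAt_le i
      have h3 := abs_le.1 (ht i)
      simp only [Finset.mem_coe, Finset.mem_product, Finset.mem_Icc]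
      refine ⟨⟨h1, ?_⟩, ?_, ?_⟩
      · rw [← hx]; exact h2
      · linarith [h3.1]
      · linarith [h3.2]
    · intro i hi j hj hij
      rw [Finset.coe_range, Set.mem_Iio] at hi hj
      simp only [Prod.mk.injEq] at hij
      refine hinj (Nat.le_of_lt_succ hi) (Nat.le_of_lt_succ hj) (funext fun k => ?_)
      fin_cases k
      · exact hij.1
      · exact hij.2
  have c1 : (Finset.Icc (0 : ℤ) ((L : ℤ) + 1)).card = L + 2 := by
    rw [Int.card_Icc]; omega
  have c2 : (Finset.Icc (-(X : ℤ) - y₀) ((X : ℤ) - y₀)).card = 2 * X + 1 := by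
    rw [Int.card_Icc]; omega
  rw [Finset.card_range, Finset.card_product, c1, c2] at key
  omega

/-! ### Slab walks ↔ bridge words starting with an east step -/

/-- **Walk ↦ word.** For a slab walk `ω ∈ Zd.sawFun 2 n (L, h)` (`0 ≤ x ≤ L` and `|y₀ + y| ≤ X`
throughout, `|y₀| ≤ X`), the word `E :: wordOf n ω` is a self-avoiding bridge word of span `L + 1` with
end height `h`, staying in the tube (`traj (E :: wordOf n ω) (i + 1) = e₀ + ω i`).
[cite: MadrasSlade1993, §1.1] -/
theorem cons_wordOf_spec {n L X : ℕ} {y₀ h : ℤ} {ω : ℕ → Site 2}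
    (hω : ω ∈ Zd.sawFun 2 n ![(L : ℤ), h]) (hy₀ : |y₀| ≤ (X : ℤ))
    (hslab : ∀ i ≤ n, (0 : ℤ) ≤ ω i 0 ∧ ω i 0 ≤ (L : ℤ) ∧ |y₀ + ω i 1| ≤ (X : ℤ)) :
    IsSAW ((0 : Step) :: wordOf n ω) ∧ IsBridgeW ((0 : Step) :: wordOf n ω) ∧
      xEnd ((0 : Step) :: wordOf n ω) = (L : ℤ) + 1 ∧ wEnd ((0 : Step) :: wordOf n ω) 1 = h ∧
      ∀ i, |y₀ + traj ((0 : Step) :: wordOf n ω) i 1| ≤ (X : ℤ) := by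
  obtain ⟨hsaws, hωn⟩ := Zd.mem_sawFun_iff_mem_saws.1 hω
  obtain ⟨-, hend, -, hinj⟩ := Zd.mem_saws.1 hsaws
  have hlen : ((0 : Step) :: wordOf n ω).length = n + 1 := by simp
  have htraj : ∀ i, traj ((0 : Step) :: wordOf n ω) (i + 1) = Step.vec 0 + ω i := fun i => by
    rw [traj_cons_succ, traj_wordOf hsaws]
  have hx : ∀ i, xAt ((0 : Step) :: wordOf n ω) (i + 1) = 1 + ω i 0 := fun i => by
    rw [xAt, htraj i, Pi.add_apply, Step.vec_apply_zero, dx_zero]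
  have hy : ∀ i, traj ((0 : Step) :: wordOf n ω) (i + 1) 1 = ω i 1 := fun i => by
    rw [htraj i, Pi.add_apply, Step.vec_apply_one, dy_zero, zero_add]
  have hslab' : ∀ i, (0 : ℤ) ≤ ω i 0 ∧ ω i 0 ≤ (L : ℤ) ∧ |y₀ + ω i 1| ≤ (X : ℤ) := fun i => by
    rcases le_or_gt i n with hi | hi
    · exact hslab i hi
    · rw [hend i hi.le]
      exact hslab n le_rfl
  have hn0 : ω n 0 = L := by rw [hωn]; rfl
  have hn1 : ω n 1 = h := by rw [hωn]; rfl
  have hxEnd : xEnd ((0 : Step) :: wordOf n ω) = (L : ℤ) + 1 := by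
    rw [xEnd, hlen, hx n, hn0, add_comm]
  refine ⟨?_, ?_, hxEnd, ?_, ?_⟩
  · -- self-avoiding: the origin is the only vertex with first coordinate `0`
    rw [isSAW_iff_injOn]
    intro i hi j hj hij
    rcases i with _ | i <;> rcases j with _ | j
    · rfl
    · exfalso
      have e := congrFun hij 0
      rw [traj_zero, Pi.zero_apply, htraj j, Pi.add_apply, Step.vec_apply_zero, dx_zero] at e
      have := (hslab' j).1
      omega
    · exfalso
      have e := congrFun hij 0
      rw [traj_zero, Pi.zero_apply, htraj i, Pi.add_apply, Step.vec_apply_zero, dx_zero] at e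
      have := (hslab' i).1
      omega
    · simp only [Set.mem_setOf_eq, hlen] at hi hj
      rw [htraj i, htraj j, add_right_inj] at hij
      rw [hinj (show i ≤ n by omega) (show j ≤ n by omega) hij]
  · -- bridge
    rw [isBridgeW_iff]
    intro i h1 h2
    obtain ⟨i, rfl⟩ : ∃ i', i = i' + 1 := ⟨i - 1, by omega⟩
    rw [hx i, hxEnd]
    have := hslab' i
    constructor <;> linarith [this.1, this.2.1]
  · -- end height
    rw [← traj_length, hlen, hy n, hn1]
  · -- tube
    intro i
    rcases i with _ | i
    · rw [traj_zero, Pi.zero_apply, add_zero]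
      exact hy₀
    · rw [hy i]
      exact (hslab' i).2.2

/-- **Word ↦ walk.** A self-avoiding bridge word `b` of span `L + 1`, end height `h`, in the tube
`|y₀ + y| ≤ X`, is `E :: b.tail`, and the trajectory of `b.tail` is a slab walk
`ω ∈ Zd.sawFun 2 (|b| - 1) (L, h)` (`0 ≤ x ≤ L`, in the tube) whose step word is `b.tail`.
[cite: MadrasSlade1993, §1.1] -/
theorem tail_spec {b : List Step} {L X : ℕ} {y₀ h : ℤ} (hs : IsSAW b) (hbr : IsBridgeW b)
    (hx : xEnd b = (L : ℤ) + 1) (hw : wEnd b 1 = h) (ht : ∀ i, |y₀ + traj b i 1| ≤ (X : ℤ)) :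
    b = (0 : Step) :: b.tail ∧
      traj b.tail ∈ Zd.sawFun 2 (b.length - 1) ![(L : ℤ), h] ∧
      (∀ i ≤ b.length - 1, (0 : ℤ) ≤ traj b.tail i 0 ∧ traj b.tail i 0 ≤ (L : ℤ) ∧
        |y₀ + traj b.tail i 1| ≤ (X : ℤ)) ∧
      wordOf (b.length - 1) (traj b.tail) = b.tail := by
  obtain ⟨d, b', rfl⟩ : ∃ d b', b = d :: b' := by
    cases b with
    | nil =>
      exfalso
      have h0 : xEnd ([] : List Step) = 0 := by simp [xEnd]
      rw [h0] at hx
      omega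
    | cons d b' => exact ⟨d, b', rfl⟩
  obtain rfl : d = 0 := head_eq_zero hbr
  simp only [List.tail_cons, List.length_cons, Nat.add_sub_cancel]
  have hs' : IsSAW b' := by simpa using hs.drop 1
  have hsaws : traj b' ∈ Zd.saws 2 b'.length := traj_mem_saws rfl hs'
  have hxAt : ∀ i, xAt ((0 : Step) :: b') (i + 1) = 1 + traj b' i 0 := fun i => by
    rw [xAt_cons_succ, dx_zero]
    rfl
  have hyAt : ∀ i, traj ((0 : Step) :: b') (i + 1) 1 = traj b' i 1 := fun i => by
    rw [traj_cons_succ, Pi.add_apply, Step.vec_apply_one, dy_zero, zero_add]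
  have hbr' := (isBridgeW_iff _).1 hbr
  refine ⟨trivial, ?_, ?_, eq_of_traj_eq (by simp) (traj_wordOf hsaws)⟩
  · rw [Zd.mem_sawFun_iff_mem_saws]
    refine ⟨hsaws, ?_⟩
    rw [traj_length]
    have e0 : wEnd b' 0 = L := by
      rw [xEnd_eq, wEnd_cons, Pi.add_apply, Step.vec_apply_zero, dx_zero] at hx
      linarith
    have e1 : wEnd b' 1 = h := by
      rw [wEnd_cons, Pi.add_apply, Step.vec_apply_one, dy_zero, zero_add] at hw
      exact hw
    funext k
    fin_cases k
    · simpa using e0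
    · simpa using e1
  · intro i hi
    have h1 := hbr' (i + 1) (by omega) (by simp only [List.length_cons]; omega)
    rw [hxAt, hx] at h1
    refine ⟨by linarith [h1.1], by linarith [h1.2], ?_⟩
    rw [← hyAt]
    exact ht (i + 1)

end SlabOfChain

end Summit.CriticalPhenomena.SAWScalingLimit.Theorems

end
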